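import Mathlib.Data.Nat.Bitwise
import Mathlib.Data.List.Basic
import Summits.MatrixMultiplication.OmegaCensus.SmallFormats.GF2FastSandwich
import HarnessLib

/-!
# MM22 venture — PROFILE-CERT kernel replay: the checker (definitions only)

HONEST FRAMING (cell `pub-mm22`, seat p1 g5; V4-MENU item (0′) «kernel replay of the whole-root PROFILE-CERT»).
Checker PLUMBING with soundness theorems, written from the FROZEN format specification
`HOME/pub-mm22-p2/pcert/PROFILE-CERT-v1-frozen-20260822T2120Z.md` (sha256 59fc6c87…) only. The end declaration of the
chain (`ProfileCertGlue.rankGe21F2_of_pieces`) is an IMPLICATION whose antecedents are Wang's `Cert 3 3 3 [] 20`, a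
certified orbit table (Wang's printed values and the cell's 8 LP/LPDFS lifts), a passing singleton check and the
`NoExt` statement that the (not yet landed) data files assemble to. NOTHING here proves a bound on `R_𝔽₂(⟨3,3,3⟩)`;
no summit claim.

This file: the executable checker for PROFILE-CERT v1, minimal rule set {P±, P N, B, S, C1, C3, C4, C8}, ROOT instance
(S = 0: forms = the 511 nonzero 9-bit patterns, bit 3i+j = entry (i,j)), chunk references, the row-dictionary and
singleton checks. Matrix primitives are the tree's `mulBits`/`trBits`; generators `(P,Q,t,Pi,Qi)` act by
`X ↦ P·X^(t)·Q` and carry inverse witnesses. Data files prove `check … = true` etc. by `decide +kernel`.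
-/

set_option autoImplicit false

namespace Summit.Ventures.MM22.ProfileCert


/-! ## 3×3 matrices over 𝔽₂ as 9-bit naturals (the tree's `mulBits`/`trBits`, bit `3i+j` = entry `(i,j)`) -/

open Summit.MatrixMultiplication.OmegaCensus.GF2RankLB in
/-- Product `P·X` of 3×3 matrices over 𝔽₂ (9-bit codes). -/
def mul3 (P X : ℕ) : ℕ := mulBits 3 3 3 P X

open Summit.MatrixMultiplication.OmegaCensus.GF2RankLB in
/-- Transpose of a 3×3 matrix over 𝔽₂ (9-bit code). -/
def tr3 (X : ℕ) : ℕ := trBits 3 3 X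

open Summit.MatrixMultiplication.OmegaCensus.GF2RankLB in
/-- The 3×3 identity (9-bit code `273`). -/
def one3 : ℕ := oneBits 3

/-- The map `X ↦ P · X^(t) · Q` of the symmetry group (t = 1: transpose first), on 9-bit form patterns. -/
def sigma (P Q t : ℕ) (X : ℕ) : ℕ := mul3 (mul3 P (if t = 1 then tr3 X else X)) Q

/-- A symmetry generator as listed by an S-node: `(P, Q, t)` and inverse witnesses `Pi = P⁻¹`, `Qi = Q⁻¹`. -/
structure MapW where
  P : ℕ
  Q : ℕ
  t : ℕ
  Pi : ℕ
  Qi : ℕ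
deriving DecidableEq, Repr

/-- The map of a generator. -/
def MapW.sigma (mp : MapW) : ℕ → ℕ := _root_.Summit.Ventures.MM22.ProfileCert.sigma mp.P mp.Q mp.t

/-- Inverse witnesses check: `P·Pi = Pi·P = 1`, `Q·Qi = Qi·Q = 1`. -/
def MapW.invOK (mp : MapW) : Bool :=
  (mul3 mp.P mp.Pi == one3) && (mul3 mp.Pi mp.P == one3) && (mul3 mp.Q mp.Qi == one3) && (mul3 mp.Qi mp.Q == one3)

/-! ## Rows, row store, state -/

/-- A cited substitution row `U`: member mask (bit `f` set iff form `f ∈ U`), member count, `cap = N − lb(U)`. -/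
structure Row where
  mask : ℕ
  size : ℕ
  cap : ℕ
deriving DecidableEq, Repr

/-- Binary-trie row store (index bits, least significant first). -/
inductive RT where
  | nil : RT
  | leaf : Row → RT
  | node : RT → RT → RT

/-- Row lookup; a missing index yields the empty row (mask 0, cap 0 — a vacuous constraint). -/
def RT.get : RT → ℕ → Row
  | .nil, _ => ⟨0, 0, 0⟩
  | .leaf r, _ => r
  | .node l r, i => if i % 2 = 0 then l.get (i / 2) else r.get (i / 2)

/-- Replay state: IN forms (list, most recent first), OUT forms (mask), and their counts. -/
structure St where
  inL : List ℕ
  out : ℕ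
  nIn : ℕ
  nOut : ℕ
deriving DecidableEq, Repr

/-- Number of forms of the root instance. -/
def NF : ℕ := 511

/-- Mask of all forms `1 … NF`. -/
def allMask : ℕ := 2 * (2 ^ NF - 1)

/-- Mask of a list of forms. -/
def maskOf : List ℕ → ℕ
  | [] => 0
  | f :: fs => 2 ^ f ||| maskOf fs

/-- `∑_{1 ≤ i ≤ n} [p i]`. -/
def countUpTo (p : ℕ → Bool) : ℕ → ℕ
  | 0 => 0
  | n + 1 => countUpTo p n + (if p (n + 1) then 1 else 0)

/-- `∑_{1 ≤ i ≤ n} g i`. -/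
def sumUpTo (g : ℕ → ℕ) : ℕ → ℕ
  | 0 => 0
  | n + 1 => sumUpTo g n + g (n + 1)

/-- `f` is a form of the root instance. -/
@[inline] def isForm (f : ℕ) : Bool := decide (1 ≤ f) && decide (f ≤ NF)

namespace St

/-- `f` is currently FREE. -/
def free (s : St) (f : ℕ) : Bool := isForm f && !(s.inL.elem f) && !(s.out.testBit f)

/-- Number of FREE forms. -/
def nFree (s : St) : ℕ := NF - s.nIn - s.nOut

/-- The FREE mask. -/
def freeMask (s : St) : ℕ := allMask ^^^ (maskOf s.inL ||| s.out)

/-- Set a (FREE) form IN. -/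
def setIn (s : St) (f : ℕ) : St := ⟨f :: s.inL, s.out, s.nIn + 1, s.nOut⟩

/-- Set a (FREE) form OUT. -/
def setOut (s : St) (f : ℕ) : St := ⟨s.inL, s.out ||| 2 ^ f, s.nIn, s.nOut + 1⟩

/-- Set a list of (FREE, distinct) forms OUT. -/
def setOutL (s : St) : List ℕ → St
  | [] => s
  | f :: fs => (s.setOut f).setOutL fs

/-- `#(IN ∩ U)`. -/
def inU (s : St) (r : Row) : ℕ := s.inL.countP fun f => r.mask.testBit f

/-- `#(FREE ∩ U)`. -/
def freeU (s : St) (r : Row) : ℕ := let m := s.freeMask &&& r.mask; countUpTo (fun f => m.testBit f) NF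

/-- `avail(U)` = number of FREE forms outside `U`. -/
def avail (s : St) (r : Row) : ℕ := s.nFree - s.freeU r

end St

/-! ## Certificate trees -/

/-- Propagation steps `P f ± rid` / `P f ± N`. -/
inductive Step where
  | pm (f rid : ℕ) : Step
  | pp (f rid : ℕ) : Step
  | pmN (f : ℕ) : Step
  | ppN (f : ℕ) : Step

/-- PROFILE-CERT v1 nodes, minimal rule set, plus chunk references.  An S-node's children form a chain
`scons O₁ kid₁ (scons O₂ kid₂ (… (slast kid_{m+1})))` carrying the orbits. -/
inductive PC where
  | c1 (rid : ℕ) : PC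
  | c3 (rid : ℕ) : PC
  | c4 : PC
  | c8 (D : ℕ) (ys : List (ℕ × ℕ)) : PC
  | seq (ss : List Step) (t : PC) : PC
  | b (f : ℕ) (tin tout : PC) : PC
  | s (maps : List MapW) (body : PC) : PC
  | scons (orbit : List ℕ) (kid rest : PC) : PC
  | slast (kid : PC) : PC
  | ref (k : ℕ) : PC

/-- The orbit list of an S-node body. -/
def PC.orbits : PC → List (List ℕ)
  | .scons o _ rest => o :: rest.orbits
  | _ => []

/-- Chain nodes (children lists of S-nodes) — only meaningful directly under an S-node. -/
def PC.isChain : PC → Bool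
  | .scons _ _ _ => true
  | .slast _ => true
  | _ => false

/-- One propagation step: `some` new state if its premise holds. -/
def stepRun (rt : RT) (N : ℕ) : Step → St → Option St
  | .pm f rid, s =>
    let r := rt.get rid
    if r.mask.testBit f && s.free f && decide (r.cap ≤ s.inU r) then some (s.setOut f) else none
  | .pp f rid, s =>
    let r := rt.get rid
    if !(r.mask.testBit f) && s.free f && decide ((s.nIn - s.inU r) + s.avail r ≤ N - r.cap)
    then some (s.setIn f) else none
  | .pmN f, s => if s.free f && decide (N ≤ s.nIn) then some (s.setOut f) else none
  | .ppN f, s => if s.free f && decide (s.nIn + s.nFree ≤ N) then some (s.setIn f) else none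

/-- Run a list of steps. -/
def stepsRun (rt : RT) (N : ℕ) : List Step → St → Option St
  | [], s => some s
  | st :: ss, s =>
    match stepRun rt N st s with
    | none => none
    | some s' => stepsRun rt N ss s'

/-- All forms `1 … n` with a set bit in `m` are mapped by `σ` into `m`. -/
def mapsInto (σ : ℕ → ℕ) (m : ℕ) : ℕ → Bool
  | 0 => true
  | n + 1 => mapsInto σ m n && (!(m.testBit (n + 1)) || m.testBit (σ (n + 1)))

/-- One BFS round: unvisited images of the frontier under all maps. Returns (visited', frontier'). -/
def bfsRound (σs : List (ℕ → ℕ)) : List ℕ → ℕ → List ℕ → ℕ × List ℕ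
  | [], vis, acc => (vis, acc)
  | x :: xs, vis, acc =>
    let step := σs.foldl (fun (va : ℕ × List ℕ) σ =>
      let y := σ x
      if va.1.testBit y then va else (va.1 ||| 2 ^ y, y :: va.2)) (vis, acc)
    bfsRound σs xs step.1 step.2

/-- BFS closure of the frontier under the maps, `fuel` rounds. Returns the visited mask. -/
def bfs (σs : List (ℕ → ℕ)) : ℕ → ℕ → List ℕ → ℕ
  | 0, vis, _ => vis
  | _ + 1, vis, [] => vis
  | n + 1, vis, fr => let r := bfsRound σs fr vis []; bfs σs n r.1 r.2

/-- Orbit checks of an S-node: nonempty, pairwise disjoint, no repeated / out-of-range entries, each closed under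
the maps and equal to the BFS closure of its head; returns the union mask (or `none` on failure). -/
def orbitsOK (σs : List (ℕ → ℕ)) : List (List ℕ) → ℕ → Option ℕ
  | [], acc => some acc
  | o :: os, acc =>
    match o with
    | [] => none
    | x₀ :: _ =>
      let m := maskOf o
      if (acc &&& m == 0) && !(m.testBit 0) && decide (o.length = countUpTo (fun f => m.testBit f) NF)
          && σs.all (fun σ => mapsInto σ m NF)
          && decide (bfs σs (o.length + 1) (2 ^ x₀) [x₀] = m)
      then orbitsOK σs os (acc ||| m) else none

/-- The maps named by an S-node's generator list. -/
def sigmas (maps : List MapW) : List (ℕ → ℕ) := maps.map MapW.sigma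

/-- Header checks of an S-node at state `s`: every generator has inverse witnesses and maps IN into IN; the orbits
partition the FREE set, are closed under the maps and are BFS-reachable from their heads.  (OUT ↦ OUT follows.) -/
def sHeaderOK (maps : List MapW) (orbits : List (List ℕ)) (s : St) : Bool :=
  maps.all (fun mp => mp.invOK && s.inL.all (fun f => s.inL.elem (mp.sigma f)))
  && (match orbitsOK (sigmas maps) orbits 0 with
      | none => false
      | some u => decide (u = s.freeMask))

/-- The C8 (integer LP dual) leaf test. -/
def c8OK (rt : RT) (N : ℕ) (s : St) (D : ℕ) (ys : List (ℕ × ℕ)) : Bool :=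
  let rows := ys.map fun (ry : ℕ × ℕ) => (rt.get ry.1, ry.2)
  let fm := s.freeMask
  rows.all (fun (r : Row × ℕ) => decide (s.inU r.1 ≤ r.1.cap))
  && (let b1 := (rows.map fun (r : Row × ℕ) => r.2 * (r.1.cap - s.inU r.1)).sum
      let sf (f : ℕ) : ℕ := (rows.map fun (r : Row × ℕ) => if r.1.mask.testBit f then r.2 else 0).sum
      let b2 := sumUpTo (fun f => if fm.testBit f then D - sf f else 0) NF
      decide (1 ≤ D) && decide (s.nIn * D + b1 + b2 < N * D))

/-- Entry state named by a chunk reference. -/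
structure Entry where
  inL : List ℕ
  out : ℕ
  nOut : ℕ
deriving DecidableEq, Repr

/-- **The replay check** of a certificate tree at a state (`refs` = entry states of externally proved chunks). -/
def check (rt : RT) (N : ℕ) (refs : List Entry) : PC → St → Bool
  | .c1 rid, s => let r := rt.get rid; decide (r.cap < s.inU r)
  | .c3 rid, s => let r := rt.get rid; decide ((s.nIn - s.inU r) + s.avail r < N - r.cap)
  | .c4, s => decide (s.nIn + s.nFree < N) || decide (N < s.nIn)
  | .c8 D ys, s => c8OK rt N s D ys
  | .seq ss t, s =>
    !t.isChain &&
    match stepsRun rt N ss s with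
    | none => false
    | some s' => check rt N refs t s'
  | .b f tin tout, s =>
    !tin.isChain && !tout.isChain && s.free f
    && check rt N refs tin (s.setIn f) && check rt N refs tout (s.setOut f)
  | .s maps body, s => body.isChain && sHeaderOK maps body.orbits s && check rt N refs body s
  | .scons o kid rest, s =>
    !kid.isChain && rest.isChain &&
    (match o with
     | [] => false
     | x₀ :: _ => check rt N refs kid (s.setIn x₀))
    && check rt N refs rest (s.setOutL o)
  | .slast kid, s => !kid.isChain && check rt N refs kid s
  | .ref k, s =>
    match refs[k]? with
    | none => false
    | some e => decide (s.inL = e.inL) && decide (s.out = e.out) && decide (s.nOut = e.nOut)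
        && decide (s.nIn = e.inL.length)

/-- Boolean well-formedness of a state (entry states of chunks are checked with this). -/
def St.wfB (s : St) : Bool :=
  decide s.inL.Nodup && s.inL.all (fun f => isForm f && !(s.out.testBit f)) && decide (s.out < 2 ^ (NF + 1))
  && !(s.out.testBit 0) && decide (s.nIn = s.inL.length) && decide (s.nOut = countUpTo (fun f => s.out.testBit f) NF)

/-! ## Row dictionary checks (§4 of the spec, root instance): every stored row is an orbit row moved by a sandwich -/

section Dict
open Summit.MatrixMultiplication.OmegaCensus.GF2RankLB

/-- All 𝔽₂-combinations of a list of vectors (2^k entries, the empty combination `0` included). -/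
def spanList : List ℕ → List ℕ
  | [] => [0]
  | v :: vs => let l := spanList vs; l ++ l.map (· ^^^ v)

/-- A dictionary row: member mask, basis, table orbit, claimed bound, an echelon basis `kr` of the orbit
representative's span (for the tree's one-pass `reduceB`), and a FAST-sandwich witness `(t, P, Pi, Q, Qi)` moving the
representative's constraint space into the row's (t = 1: transposed sandwich). -/
structure RowSrc where
  mask : ℕ
  basis : List ℕ
  orbit : ℕ
  lb : ℕ
  kr : List ℕ
  t : ℕ
  P : ℕ
  Pi : ℕ
  Q : ℕ
  Qi : ℕ
deriving Repr

/-- Entry check: the mask is the span of the basis without `0`, `lb` is the table bound of the orbit, `kr` lies in the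
span of the table representative's basis, and the witness passes the tree's fast sandwich check from `kr` to this basis. -/
def RowSrc.ok (reps : ℕ → List ℕ × ℕ) (r : RowSrc) : Bool :=
  let rep := reps r.orbit
  let sp := spanList rep.1
  decide (r.mask = maskOf (spanList r.basis) ^^^ 1) && decide (rep.2 = r.lb) && r.kr.all (fun x => sp.elem x)
  && (if r.t = 1 then sandTFB 3 r.kr r.basis r.P r.Pi r.Q r.Qi else sandFB 3 3 r.kr r.basis r.P r.Pi r.Q r.Qi)

/-- Every leaf of the row store satisfies `p`. -/
def RT.allLeaves (p : Row → Bool) : RT → Bool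
  | .nil => true
  | .leaf r => p r
  | .node l r => l.allLeaves p && r.allLeaves p

/-- Dictionary check of a row store for `N` terms: all entries check, and every stored row is matched (by mask) by an
entry whose bound covers its cap (`N ≤ lb + cap`). -/
def dictOK (N : ℕ) (reps : ℕ → List ℕ × ℕ) (rt : RT) (dict : List RowSrc) : Bool :=
  dict.all (RowSrc.ok reps)
  && rt.allLeaves (fun row => (row.mask == 0) || dict.any (fun r => r.mask == row.mask && decide (N ≤ r.lb + row.cap)))

/-- Singleton witnesses: for every form `x` an orbit and a fast sandwich from the orbit representative to `[x]`. -/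
structure Single where
  x : ℕ
  orbit : ℕ
  P : ℕ
  Pi : ℕ
  Q : ℕ
  Qi : ℕ
deriving Repr

/-- Singles check for bound `b`: every form `1 … NF` is listed (in order) with an orbit of table bound `≥ b` and a
passing fast sandwich. -/
def singlesOK (b : ℕ) (reps : ℕ → List ℕ × ℕ) (ws : List Single) : Bool :=
  decide (ws.map Single.x = (List.range NF).map (· + 1))
  && ws.all (fun w => decide (b ≤ (reps w.orbit).2) && sandFB 3 3 (reps w.orbit).1 [w.x] w.P w.Pi w.Q w.Qi)

end Dict


end Summit.Ventures.MM22.ProfileCert
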